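import Mathlib
import Literature.NumberTheory.LFunctions.XiMoments
import Literature.NumberTheory.LFunctions.XiTiltedPotential
import Literature.NumberTheory.LFunctions.XiGaussModeMap
import Literature.NumberTheory.LFunctions.DeBruijnPhiLogDerivEnvelope
import Literature.NumberTheory.LFunctions.DeBruijnPhiDecreasing
import Literature.NumberTheory.LFunctions.DeBruijnNewmanProofs
import HarnessLib

/-!
# DeBruijnPhiLogConcaveSqrt

Topic `Literature/NumberTheory/LFunctions`. Named literature fact(s) relocated by the gate from `Summits/RiemannHypothesis/RiemannHypothesis/Theorems/JensenPolynomialsXiDeltaSqPosOfLogConcaveSqrt.lean`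
(accept-time relocation of `[cite]`d propositions written inline in a Summits proposal; human ruling 2026-08-15).
Sources: CsordasNorfolkVarga1986.

* `Literature.NumberTheory.LFunctions.DeBruijnPhiLogConcaveSqrt`
-/

namespace Literature.NumberTheory.LFunctions

open Literature.NumberTheory.LFunctions MeasureTheory Set Filter
open scoped Topology Nat

/-- **Csordas–Norfolk–Varga 1986 — the key lemma behind the Turán inequalities for `ξ`**: for the Pólya–de Bruijn
kernel `Φ = deBruijnPhi`, `log Φ(√t)` is concave for `t > 0`; equivalently (Dimitrov–Lucas' remark after their
Theorem B: "(8) is equivalent to `(d/dt)(K′(t)/(tK(t))) < 0`") the function `u ↦ −Φ′(u)/(uΦ(u))` is non-decreasing on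
`(0, ∞)`.  Proved in print by a lengthy analysis of `Φ` near `0` (fourth-order behaviour of `log Φ`); in the tree so far
only on `[1, ∞)` (`strictMonoOn_phiNegLogDeriv_div`, from Coffey–Csordas' quantitative log-concavity).
[cite: CsordasNorfolkVarga1986, the concavity of log Φ(√t) (= DimitrovLucas2011, Theorem B)]
[file NumberTheory/LFunctions/DeBruijnPhiLogConcaveSqrt] -/
def DeBruijnPhiLogConcaveSqrt : Prop :=
  MonotoneOn (fun u : ℝ => -deBruijnPhiDeriv u / (u * deBruijnPhi u)) (Set.Ioi 0)

end Literature.NumberTheory.LFunctions
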